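import Literature.Probability.LatticeModels.ScalingLimit3D
import HarnessLib

/-!
# Crux DeviceWeylUniversality (stmt-CriticalPhenomena-4722), line `birth` — stub `stub_limitZero` (Z0)

Route `ConformalPoissonDevice`, sub-problem `Ising3DConformalLimit`; stub Z0 of the skeleton of the
line `birth`: **the `0`-point pointwise scaling limit of the critical `ℤ³` correlators is `1`.**
For any renormalisation `ρ` and any pointwise scaling limit `S` of `criticalCorr 3` (no positivity of
`ρ` needed), `S 0 x = 1` for every (empty) configuration `x : Fin 0 → ℝ³`.

**Proof.** At `n = 0` the rescaled correlator is `ρ(δ)⁰ · ⟨∏_{i ∈ ∅} σ⟩⁺_{β_c,0} = ⟨1⟩⁺ = 1` for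
every mesh `δ`: the spin monomial over `Fin 0` is the constant `1`, each finite-volume Gibbs
expectation of `1` is `1` (the Gibbs measure is a probability measure), and the `limUnder` along boxes
of a constant sequence is that constant. The empty configuration is non-coincident, so
`TendstoLocallyUniformlyOn.tendsto_at` gives convergence of the constant `1` to `S 0 x` along the
(non-trivial) filter `𝓝[>] 0`, and limits are unique.

Sources: folklore; tree API `Literature/Probability/LatticeModels/ScalingLimit.lean`
(`HasPointwiseScalingLimit`, `rescaledCorrelator_apply`, `NonCoincident`),
`Literature/Probability/LatticeModels/IsingThermodynamics.lean` (`criticalCorr`, `plusExpect`),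
`Literature/Probability/LatticeModels/IsingModel.lean` (`isingExpect`, `isingMeasure` probability).
-/

noncomputable section

open Filter Topology MeasureTheory
open Literature.Probability.LatticeModels

namespace Summit.CriticalPhenomena.Ising3DConformalLimit.Theorems.DeviceWeylUniversality

namespace StubLimitZero

/-- The spin monomial of the empty family of sites is the constant observable `1`. [folklore] -/
theorem spinMonomial_fin_zero {V : Type*} (y : Fin 0 → V) :
    (spinMonomial y : SpinConfig V → ℝ) = fun _ => 1 := by
  funext s
  simp [spinMonomial]

/-- The plus state of the constant observable `1` is `1`: every finite-volume Gibbs expectation of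
`1` is `1` (probability measure), and the `limUnder` of a constant box sequence is that constant.
[folklore] -/
theorem plusExpect_const_one (d : ℕ) (β h : ℝ) :
    plusExpect d β h (fun _ => (1 : ℝ)) = 1 := by
  have hc : (fun L : ℕ => isingExpect (zdGraph d) (box d L) β h .plus fun _ => (1 : ℝ)) =
      fun _ => 1 := by
    funext L
    simp [isingExpect]
  rw [plusExpect, hc]
  exact tendsto_const_nhds.limUnder_eq

/-- The critical `0`-point correlator of `ℤ^d` is `1`: `⟨∏_{i ∈ ∅} σ_{yᵢ}⟩⁺_{β_c,0} = ⟨1⟩⁺ = 1`.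
[folklore] -/
theorem criticalCorr_zero (d : ℕ) (y : Fin 0 → Site d) : criticalCorr d 0 y = 1 := by
  change plusExpect d (criticalBeta d) 0 (spinMonomial y) = 1
  rw [spinMonomial_fin_zero]
  exact plusExpect_const_one d _ 0

/-- At `n = 0` the rescaled critical correlator is the constant `1` in the mesh, for every `ρ`.
[folklore] -/
theorem rescaledCorrelator_criticalCorr_zero (d : ℕ) (ρ : ℝ → ℝ) (δ : ℝ)
    (x : Fin 0 → EuclideanSpace ℝ (Fin d)) :
    rescaledCorrelator (criticalCorr d) ρ 0 δ x = 1 := by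
  rw [rescaledCorrelator_apply, pow_zero, one_mul, criticalCorr_zero]

end StubLimitZero

open StubLimitZero in
/-- **Stub Z0 — the `0`-point scaling limit is `1`.** For any pointwise scaling limit `S` of the
critical `ℤ³` correlators (any renormalisation `ρ`), `S 0 ≡ 1`: the rescaled `0`-point correlator is
`ρ(δ)⁰ · ⟨1⟩⁺_{β_c} = 1` for every mesh, the empty configuration is non-coincident, and limits along
the non-trivial filter `𝓝[>] 0` are unique. [folklore] -/
theorem stub_limitZero :
    ∀ (ρ : ℝ → ℝ) (S : Literature.Probability.LatticeModels.CorrFamily 3),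
    Literature.Probability.LatticeModels.HasPointwiseScalingLimit
      (Literature.Probability.LatticeModels.criticalCorr 3) ρ S
    → ∀ x : Fin 0 → EuclideanSpace ℝ (Fin 3), S 0 x = 1 := by
  intro ρ S hlim x
  have hx : x ∈ NonCoincident 3 0 := fun i => i.elim0
  have ht : Tendsto (fun δ : ℝ => rescaledCorrelator (criticalCorr 3) ρ 0 δ x) (𝓝[>] (0 : ℝ))
      (𝓝 (S 0 x)) := (hlim 0).tendsto_at hx
  have h1 : (fun δ : ℝ => rescaledCorrelator (criticalCorr 3) ρ 0 δ x) = fun _ => (1 : ℝ) :=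
    funext fun δ => rescaledCorrelator_criticalCorr_zero 3 ρ δ x
  rw [h1] at ht
  exact tendsto_nhds_unique ht tendsto_const_nhds

end Summit.CriticalPhenomena.Ising3DConformalLimit.Theorems.DeviceWeylUniversality

end
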